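import Literature.AlgebraicGeometry.HodgeTheory.CubicFourfoldHodgeConjectureProofs
import Literature.AlgebraicGeometry.Motives.ChowZeroSupportedOnHyperplaneSection
import Literature.Barriers.HodgeConjecture.DecompositionOfTheDiagonalDegreeFourOfGysin
import HarnessLib

/-!
# The Hodge conjecture for cubic fourfolds: the `CH₀`-hypothesis is a theorem (Zucker 1977 / Murre 1977 via Bloch–Srinivas)

Family `hodge`, layer `Literature/AlgebraicGeometry/HodgeTheory`. Second companion ("Proofs") file of
`CubicFourfoldHodgeConjecture` (named fact `hodgeTwoTwo_algebraic_cubicFourfold`: Zucker,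
Compositio Math. 34 (1977), (3.2) Theorem, p. 205; Murre, Indag. Math. 80 (1977), Corollary p. 230),
after `CubicFourfoldHodgeConjectureProofs`, whose route 1 (Murre's Corollary through Voisin II,
Prop. 10.26 = Bloch–Srinivas / Conte–Murre) had TWO inputs: the named fact
`Literature.Barriers.HodgeConjecture.BlochSrinivas1983_hodgeConjectureDegreeFour_of_chowZeroSupported`
(Prop. 10.26 on real carriers) and the explicit hypothesis "`CH₀` of a smooth cubic fourfold is
supported on a hyperplane section, point by point" (`hodgeTwoTwo_algebraic_cubicFourfold_of_forall_point`).
The second input is now PROVED on the tree's carriers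
(`Motives.exists_forall_isRationallyEquivalent_primeCycle_of_sum_degree_succ_le`,
`Motives/ChowZeroSupportedOnHyperplaneSection`: a line through every closed point by
Esnault–Levine–Viehweg Lemma 4.2 a), two linearly equivalent hyperplane sections of the line, and
Fulton's Example 2.5.1 — a hyperplane meets a line in one point with multiplicity one), so:

* `exists_forall_isRationallyEquivalent_primeCycle_of_isSmoothHypersurface` — for a smooth complex
  hypersurface of degree `1 ≤ e ≤ n = dim`, every closed point is rationally equivalent to a
  `0`-cycle on a fixed proper closed subset (a hyperplane section);
* `hasChowZeroSupportedInDimLE_of_isSmoothHypersurface` (`CH₀` supported in dimension `≤ n - 1`),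
  `hasChowZeroSupportedInDimLE_three_of_isSmoothHypersurface_cubicFourfold` — **a smooth cubic
  fourfold satisfies the hypothesis of Prop. 10.26** (`HasChowZeroSupportedInDimLE X 3`; Voisin's
  remark after Prop. 10.26, Murre p. 230 "covered by lines");
* `mem_algebraicClasses_two_of_isSmoothHypersurface_four_of_blochSrinivas` — Prop. 10.26 covers all
  smooth hypersurface fourfolds of degree `≤ 4` (quartics: the degree-`4` part of Conte–Murre 1978);
* `hodgeTwoTwo_algebraic_cubicFourfold_of_blochSrinivas` — **the named fact follows from
  Prop. 10.26 ALONE**; `hodgeTwoTwo_algebraic_cubicFourfold_of_gysin_of_resolutions` — its leaf set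
  (a Hodge-compatible Gysin formalism `G`, Hironaka, Hodge models, Prop. 9.20 on products, Lefschetz
  `(1,1)`, the Hodge conjecture in dimension `≤ 3`);
  `hodgeTwoTwo_algebraic_cubicFourfold_of_hodgeClassCorrespondenceAction` —
  on the current trust base (decomposition of the diagonal PROVED, `CH₀` PROVED), the only
  remaining input is the action of correspondences on `H⁴(X(ℂ); ℂ)` with its degree-`4` Hodge-class
  properties ("(F1)", the Gysin / cycle-class CONSTRUCTION behind
  `HodgeTheory.HodgeClassCorrespondenceAction`).

The unconditional discharge `hodgeTwoTwo_algebraic_cubicFourfold_holds` therefore awaits exactly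
`BlochSrinivas1983_hodgeConjectureDegreeFour_of_chowZeroSupported_holds`.

## References

* [Zucker1977] S. Zucker, The Hodge conjecture for cubic fourfolds, Compositio Math. 34 (1977)
  199–209, (3.2) Theorem (p. 205).
* [Murre1977] J. P. Murre, On the Hodge conjecture for unirational fourfolds, Indag. Math. 80
  (1977) 230–232, Theorem and Corollary (p. 230).
* [VoisinHodgeII2003] C. Voisin, Hodge Theory and Complex Algebraic Geometry II, Prop. 10.26 and
  the remark following it (§10.2.3), Cor. 10.21.
* [EsnaultLevineViehweg1997] H. Esnault, M. Levine, E. Viehweg, Duke Math. J. 87 (1997), Lemma 4.2 a).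
* [Fulton1998] W. Fulton, Intersection Theory, Example 2.5.1, Def. 2.3, Prop. 2.3 (c).
* [ConteMurre1978] A. Conte, J. P. Murre, The Hodge conjecture for fourfolds admitting a covering
  by rational curves, Math. Ann. 238 (1978) 79–88 (cite-only).
-/

noncomputable section

open CategoryTheory AlgebraicGeometry MonoidalCategory
open Literature.AlgebraicTopology.SingularHomology

namespace Literature.AlgebraicGeometry.HodgeTheory

open Literature.Barriers.HodgeConjecture Literature.AlgebraicGeometry.Motives Order

section HodgeTheory

variable {n e : ℕ} {X : Motives.SchemeOver ℂ}

/-- **`CH₀` of a smooth complex hypersurface of degree `e ≤ dim` is supported on a hyperplane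
section, point by point** (the case `Σ dⱼ + 1 ≤ N` of
`Motives.exists_forall_isRationallyEquivalent_primeCycle_of_sum_degree_succ_le` for one form:
`e + 1 ≤ n + 1`): for `X` with `Motives.IsSmoothHypersurface n e X`, `1 ≤ e ≤ n`, there is a proper
Zariski-closed `W ⊊ X` such that every closed point of `X` is rationally equivalent on `X` to a
`0`-cycle supported on `W`. [cite: VoisinHodgeII2003, remark following Prop. 10.26 (§10.2.3)]
[cite: EsnaultLevineViehweg1997, Lemma 4.2 a) (l = 1)] -/
theorem exists_forall_isRationallyEquivalent_primeCycle_of_isSmoothHypersurface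
    (hX : Motives.IsSmoothHypersurface n e X) (he : 0 < e) (hen : e ≤ n) :
    ∃ W : Set ↥X.left, IsClosed W ∧ W ≠ Set.univ ∧
      ∀ x : ↥X.left, height x = 0 →
        ∃ c' ∈ Motives.cyclesOfDim X.left 0, (∀ z, c' z ≠ 0 → z ∈ W) ∧
          Motives.IsRationallyEquivalent (Motives.primeCycle x) c' 0 := by
  obtain ⟨hsp, F, hF, -, -, i, hi, hV⟩ := hX
  haveI := hi
  haveI := hsp.smoothOfRelativeDimension
  haveI : Smooth X.hom := SmoothOfRelativeDimension.smooth n _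
  haveI : LocallyOfFiniteType X.hom := inferInstance
  haveI : IsIntegral X.left := Motives.IsSmoothProjective.isIntegral_holds hsp
  refine Motives.exists_forall_isRationallyEquivalent_primeCycle_of_sum_degree_succ_le i ![F] ![e]
    (fun j => by fin_cases j; exact hF) (fun j => by fin_cases j; exact he)
    (by rw [Fin.sum_univ_one]; exact Nat.succ_le_succ hen) ?_
  rw [hV, Matrix.range_cons, Matrix.range_empty, Set.union_empty]

/-- **`CH₀` of a smooth complex hypersurface of degree `1 ≤ e ≤ n = dim` is supported on a closed
algebraic subset of dimension `≤ n - 1`** (a hyperplane section; `HasChowZeroSupportedInDimLE`,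
the hypothesis of Voisin II, Thm. 10.4 / Prop. 10.26): lines through every point and
`chowZeroSupportedInDimLE_of_forall_point`. [cite: VoisinHodgeII2003, remark following Prop. 10.26 (§10.2.3)]
[cite: EsnaultLevineViehweg1997, Lemma 4.2 a) (l = 1)] -/
theorem hasChowZeroSupportedInDimLE_of_isSmoothHypersurface
    (hX : Motives.IsSmoothHypersurface n e X) (he : 0 < e) (hen : e ≤ n) :
    HasChowZeroSupportedInDimLE X (n - 1) := by
  obtain ⟨W, hW, hWu, hpt⟩ :=
    exists_forall_isRationallyEquivalent_primeCycle_of_isSmoothHypersurface hX he hen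
  exact ⟨W, chowZeroSupportedInDimLE_of_forall_point hX.1 (by omega) hW hWu hpt⟩

/-- **The `CH₀`-hypothesis of the Bloch–Srinivas / Conte–Murre route holds for smooth cubic
fourfolds**: every smooth cubic fourfold `X ⊂ ℙ⁵_ℂ` has `CH₀(X)` supported on a closed algebraic
subset of dimension `≤ 3` (a hyperplane section; `HasChowZeroSupportedInDimLE X 3`, the hypothesis
of Voisin II, Prop. 10.26 = `BlochSrinivas1983_hodgeConjectureDegreeFour_of_chowZeroSupported`):
lines through every point (`3 + 1 ≤ 5`) and `chowZeroSupportedInDimLE_of_forall_point`.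
[cite: VoisinHodgeII2003, Prop. 10.26 and the remark following it (§10.2.3)]
[cite: Murre1977, Theorem and Corollary, p. 230] -/
theorem hasChowZeroSupportedInDimLE_three_of_isSmoothHypersurface_cubicFourfold
    (hX : Motives.IsSmoothHypersurface 4 3 X) : HasChowZeroSupportedInDimLE X 3 := by
  obtain ⟨W, hW, hWu, hpt⟩ :=
    exists_forall_isRationallyEquivalent_primeCycle_of_isSmoothHypersurface hX (by norm_num)
      (by norm_num)
  exact ⟨W, chowZeroSupportedInDimLE_of_forall_point hX.1 (by norm_num) hW hWu hpt⟩

/-- **Prop. 10.26 applies to every smooth hypersurface fourfold of degree `≤ 4`** (quadric, cubic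
and quartic fourfolds in `ℙ⁵_ℂ`: `e + 1 ≤ 5` gives a line through every point): granted
`BlochSrinivas1983_hodgeConjectureDegreeFour_of_chowZeroSupported`, every rational `(2,2)`-class
on such an `X` is algebraic — for `e = 4` the degree-`4` part of Conte–Murre's theorem on quartic
fourfolds (Math. Ann. 238 (1978); their quintic case uses conics and is not covered here).
[cite: VoisinHodgeII2003, Prop. 10.26 and the remark following it (§10.2.3)] [cite: ConteMurre1978] -/
theorem mem_algebraicClasses_two_of_isSmoothHypersurface_four_of_blochSrinivas
    (h : BlochSrinivas1983_hodgeConjectureDegreeFour_of_chowZeroSupported)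
    (hX : Motives.IsSmoothHypersurface 4 e X) (he : 0 < e) (he4 : e ≤ 4)
    (c : Literature.AlgebraicTopology.SingularHomology.singularCohomology ℂ ℂ
      (Motives.ComplexPoints X) (2 * 2))
    (hc : IsRationalClass c) (h22 : IsOfHodgeType 4 X (2 * 2) 2 2 c) : c ∈ algebraicClasses X 2 :=
  h hX.1 (hasChowZeroSupportedInDimLE_of_isSmoothHypersurface hX he he4) c hc h22

/-- **The Hodge conjecture for cubic fourfolds (Zucker 1977, Thm. (3.2); Murre 1977, Corollary)
follows from Bloch–Srinivas' Prop. 10.26 alone**: the `CH₀`-hypothesis of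
`hodgeTwoTwo_algebraic_cubicFourfold_of_forall_point` is now a theorem
(`exists_forall_isRationallyEquivalent_primeCycle_of_isSmoothHypersurface`), so the named fact
`hodgeTwoTwo_algebraic_cubicFourfold` is reduced to the single named fact
`BlochSrinivas1983_hodgeConjectureDegreeFour_of_chowZeroSupported` (Voisin II, Prop. 10.26, whose
discharge awaits the Gysin / cycle-class construction on `H*(X(ℂ); ℂ)`).
[cite: Zucker1977, (3.2) Theorem, p. 205] [cite: Murre1977, Theorem and Corollary, p. 230]
[cite: VoisinHodgeII2003, Prop. 10.26 and the remark following it (§10.2.3)] -/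
theorem hodgeTwoTwo_algebraic_cubicFourfold_of_blochSrinivas
    (h : BlochSrinivas1983_hodgeConjectureDegreeFour_of_chowZeroSupported) :
    hodgeTwoTwo_algebraic_cubicFourfold :=
  hodgeTwoTwo_algebraic_cubicFourfold_of_forall_point h fun _ hX =>
    exists_forall_isRationallyEquivalent_primeCycle_of_isSmoothHypersurface hX (by norm_num)
      (by norm_num)

/-- **On the tree's current trust base**: the Hodge conjecture for cubic fourfolds follows from the
decomposition of the diagonal (PROVED, `BlochSrinivas1983_decompositionOfTheDiagonal_holds`), the
`CH₀`-support of cubic fourfolds (PROVED here) and an action of correspondences on `H⁴(X(ℂ); ℂ)`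
with its two degree-`4` Hodge-class properties for every smooth projective variety (the hypothesis
datum `HodgeClassCorrespondenceAction`, "(F1)": the one remaining non-constructive input).
[cite: VoisinHodgeII2003, Prop. 10.26 (proof, §10.2.3) and Cor. 10.21]
[cite: Zucker1977, (3.2) Theorem, p. 205] -/
theorem hodgeTwoTwo_algebraic_cubicFourfold_of_hodgeClassCorrespondenceAction
    (h1 : ∀ (n : ℕ) (X : Motives.SchemeOver ℂ),
      Motives.IsSmoothProjective n X → Nonempty (HodgeClassCorrespondenceAction n X)) :
    hodgeTwoTwo_algebraic_cubicFourfold :=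
  hodgeTwoTwo_algebraic_cubicFourfold_of_blochSrinivas
    (BlochSrinivas1983_hodgeConjectureDegreeFour_of_chowZeroSupported_of_facts
      BlochSrinivas1983_decompositionOfTheDiagonal_holds h1)

/-- **The leaf set of the discharge of `hodgeTwoTwo_algebraic_cubicFourfold`** (through
`BlochSrinivas1983_hodgeConjectureDegreeFour_of_chowZeroSupported_of_gysin_of_resolutions`,
`Literature/Barriers/HodgeConjecture/DecompositionOfTheDiagonalDegreeFourOfGysin`): a Gysin /
cycle-class formalism `G` on `H*(X(ℂ); ℂ)` whose Gysin morphisms are Hodge compatible (the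
CONSTRUCTION the tree lacks), projective Hironaka, the existence of Hodge models, Prop. 9.20 on
products (`hcupA`), Lefschetz `(1,1)` and the Hodge conjecture in dimension `≤ 3` — the
decomposition of the diagonal and the `CH₀`-support of cubic fourfolds being PROVED.
[cite: VoisinHodgeII2003, Prop. 10.26 and its proof (§10.2.3, p. 306)] [cite: Zucker1977, (3.2) Theorem, p. 205]
[cite: Murre1977, Theorem and Corollary, p. 230] -/
theorem hodgeTwoTwo_algebraic_cubicFourfold_of_gysin_of_resolutions (G : GysinFormalism)
    (hG : G.IsGysinHodgeCompatible) (hH : Resolution.Hironaka1964_projective.{0})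
    (hM : ∀ (m : ℕ) (Y : Motives.SchemeOver ℂ), nonempty_hodgeModel m Y)
    (hcupA : ∀ ⦃n m : ℕ⦄ ⦃X Y : Motives.SchemeOver ℂ⦄, Motives.IsSmoothProjective n X →
      Motives.IsSmoothProjective m Y →
      ∀ ⦃x : complexBetti (X ⊗ Y) (2 * 2)⦄ ⦃y : complexBetti (X ⊗ Y) (2 * m)⦄,
        x ∈ algebraicClasses (X ⊗ Y) 2 → y ∈ algebraicClasses (X ⊗ Y) m →
          cupProduct (two_mul_add_two_mul 2 m) x y ∈ algebraicClasses (X ⊗ Y) (2 + m))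
    (h11 : lefschetzOneOne_rational) (h3 : hodgeClasses_algebraic_of_dim_le_three) :
    hodgeTwoTwo_algebraic_cubicFourfold :=
  hodgeTwoTwo_algebraic_cubicFourfold_of_blochSrinivas
    (BlochSrinivas1983_hodgeConjectureDegreeFour_of_chowZeroSupported_of_gysin_of_resolutions G hG hH
      hM hcupA h11 h3)

end HodgeTheory

end Literature.AlgebraicGeometry.HodgeTheory

end
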